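import Summits.NavierStokesRegularity.NavierStokesRegularity.Theorems.ScenarioCensusModeRank
import HarnessLib

/-!
# LINE «mode-rank» port, part 2/4: spatial Liouville lemmas for the shells `μ ≥ 0` (§A4); the instrument `vortB` / `vortNL`, spans of modes, Type-I decay of slices (§B)

Re-homed for the scenario census (typer seat ns-census-typer-1 g8; the cells A1sh / A1sep are MEMBERS OF RECORD «DECIDED IN KERNEL IN FILES» of row
A1apT since census v1.71 (critic idea-crit-3 g6 PASS — no price 20:24:04Z; ref ns-census-ref g8 PRE-CHECK ✓ §13.14 item 9; lead-presearch label); this port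
makes them TREE-decided): VERBATIM PORT of ns-idea-2 LINE g12-1 «mode-rank», `pub/ideators/ns-idea-2/lines/mode-rank/line-mode-rank.lean` sha16
fb66c8a2d8442bee (1040 l., lean check rc 0, 0 sorry), split for the 400-line rule into `ScenarioCensusModeRank` (§A1–§A3) → `…ModeRankSpatial` (§A4, §B
instrument) → `…ModeRankShell` (§B decaying shell, `Row_A1sh`) → `…ModeRankRows` (§B separable row, head cell, census KEYS).  Lean text VERBATIM in namespace
`…Theorems.ScenarioCensus.ModeRank` (the line's `…Lines.ModeRank` re-homed); port edits: the two `local notation "E3"` lines (inside `section Spatial` /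
`section Rows`) → one `abbrev E3` at namespace level and the bracket lines `section Rows` / `end Rows` dropped (no `variable`s in that section; typer lint: no
notation in port files), `@[conjecture]` on the OPEN head cell `Row_A1rk` (typed only, no witness); the helper `abs_apply_le_norm` (`|z i| ≤ ‖z‖`, a verbatim twin of a landed
Literature lemma — gate lint `dedup.landed`) is not re-declared and its single use in `curl_eq_zero_of_negShell` is Mathlib's `PiLp.norm_apply_le`; likewise
`tendsto_typeI_bound` (`C/√(-s) → 0`, twin of a landed tree lemma in a module the farm does not build) is not re-declared and its single use in
`tendsto_slice_atBot` carries the one-line Mathlib proof inline (proof text only).  Statements untouched.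

No census VALUE is moved here (row A1apT keeps its value; the members become TREE-decided by name); NS regularity is NOT proved; (L′)
`TypeIAncientLiouville` ⟨10661⟩ is untouched; no summit statement is proved by this file.
-/

-- the summit and its single problem share the name `NavierStokesRegularity` (D-0017 nested layout)
set_option linter.dupNamespace false

noncomputable section

open Set Function Filter Topology

namespace Summit.NavierStokesRegularity.NavierStokesRegularity.Theorems.ScenarioCensus.ModeRank

open Literature.Analysis Literature.Analysis.FluidPDE InnerProductSpace
open Summit.NavierStokesRegularity.NavierStokesRegularity.Theorems (vorticity_eq_deriv_of_typeI)
open scoped Laplacian InnerProductSpace RealInnerProductSpace ContDiff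

section Spatial

/-! ### A4. Spatial Liouville lemmas for the shells `μ ≥ 0`. -/

/-- A bounded harmonic vector field on `ℝ³` is constant (componentwise Liouville). -/
theorem apply_eq_apply_of_harmonic_bounded {w : E3 → E3} (hw : ContDiff ℝ 2 w)
    (hΔ : ∀ x, (Δ w) x = 0) {A : ℝ} (hA : ∀ x, ‖w x‖ ≤ A) (x y : E3) : w x = w y := by
  ext i
  set η : E3 → ℝ := fun z => w z i with hη
  have hηeq : η = (EuclideanSpace.proj i : E3 →L[ℝ] ℝ) ∘ w := by funext z; rfl
  have hη2 : ContDiff ℝ 2 η := by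
    rw [hηeq]; exact (EuclideanSpace.proj i : E3 →L[ℝ] ℝ).contDiff.comp hw
  have hηΔ : ∀ z, (Δ η) z = 0 := fun z => by
    rw [hηeq, hw.contDiffAt.laplacian_CLM_comp_left, Function.comp_apply, hΔ z, map_zero]
  have hharm : HarmonicOnNhd η univ := harmonicOnNhd_of_laplacian_eq_zero hη2 hηΔ
  have hbdd : ∀ z, |η z| ≤ A := fun z =>
    le_trans (by simpa [hη, Real.norm_eq_abs] using PiLp.norm_apply_le (w z) i) (hA z)
  exact hharm.apply_eq_apply_of_abs_le hbdd x y

/-- A bounded divergence-free `C²` field on `ℝ³` with spatially constant curl is constant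
(`Δ V = -curl curl V = 0`, then Liouville). -/
theorem apply_eq_apply_of_curl_const {V : E3 → E3} (hV : ContDiff ℝ 2 V) {b : E3}
    (hcurl : ∀ x, curl V x = b) (hdiv : VectorCalculus.IsDivFree V) {M : ℝ}
    (hM : ∀ x, ‖V x‖ ≤ M) (x y : E3) : V x = V y := by
  have hc : curl V = fun _ => b := funext hcurl
  have hΔ : ∀ z, (Δ V) z = 0 := fun z => by
    rw [laplacian_eq_neg_curl_curl hV hdiv z, hc, curl_eq_zero_of_fderiv_eq_zero (by simp),
      neg_zero]
  exact apply_eq_apply_of_harmonic_bounded hV hΔ hM x y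

/-- One-sided positive-eigenvalue Liouville lemma (maximum principle with the barrier `δ‖x‖²`):
a `C²` function bounded above with `Δ f = μ f`, `μ > 0`, is `≤ 0`. -/
theorem nonpos_of_laplacian_eq_mul {f : E3 → ℝ} (hf : ContDiff ℝ 2 f) {μ : ℝ} (hμ : 0 < μ)
    (hΔ : ∀ x, (Δ f) x = μ * f x) {A : ℝ} (hA : ∀ x, f x ≤ A) (y : E3) : f y ≤ 0 := by
  by_contra hy
  push Not at hy
  have hden : 0 < ‖y‖ ^ 2 + 6 / μ := by positivity
  set δ : ℝ := f y / (2 * (‖y‖ ^ 2 + 6 / μ)) with hδ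
  have hδ0 : 0 < δ := by positivity
  set h : E3 → ℝ := fun x => f x - δ * ‖x‖ ^ 2 with hh
  have hcont : Continuous h := hf.continuous.sub (continuous_const.mul (continuous_norm.pow 2))
  have h0 : h 0 = f 0 := by simp [hh]
  have hev : ∀ᶠ x in cocompact E3, h x ≤ h 0 := by
    have hR := (tendsto_norm_cocompact_atTop (E := E3)).eventually
      (eventually_ge_atTop (max 1 ((A - f 0) / δ)))
    filter_upwards [hR] with x hx
    have hx1 : 1 ≤ ‖x‖ := (le_max_left _ _).trans hx
    have hx2 : (A - f 0) / δ ≤ ‖x‖ := (le_max_right _ _).trans hx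
    have hx3 : (A - f 0) / δ ≤ ‖x‖ ^ 2 := hx2.trans (by nlinarith)
    have hx4 : A - f 0 ≤ δ * ‖x‖ ^ 2 := by
      rw [div_le_iff₀ hδ0] at hx3; linarith
    rw [h0]
    show f x - δ * ‖x‖ ^ 2 ≤ f 0
    linarith [hA x]
  obtain ⟨x₀, hx₀⟩ := hcont.exists_forall_ge' 0 hev
  have hmax : IsLocalMax h x₀ := Filter.Eventually.of_forall fun z => hx₀ z
  have hn2 : ContDiff ℝ 2 (fun w : E3 => ‖w‖ ^ 2) := contDiff_norm_sq ℝ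
  have hh2 : ContDiff ℝ 2 h := hf.sub (contDiff_const.mul hn2)
  have hΔh : (Δ h) x₀ = μ * f x₀ - δ * 6 := by
    have e1 : h = f - δ • (fun w : E3 => ‖w‖ ^ 2) := by
      funext z; simp [hh]
    have hs : ContDiffAt ℝ 2 (δ • fun w : E3 => ‖w‖ ^ 2) x₀ :=
      (show ContDiff ℝ 2 (δ • fun w : E3 => ‖w‖ ^ 2) from hn2.const_smul δ).contDiffAt
    rw [e1, hf.contDiffAt.laplacian_sub hs, InnerProductSpace.laplacian_smul δ hn2.contDiffAt,
      hΔ x₀, Literature.Analysis.PDE.PoissonBall.laplacian_norm_sq, finrank_euclideanSpace_fin]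
    simp only [smul_eq_mul]
    push_cast
    ring
  have hle : (Δ h) x₀ ≤ 0 := laplacian_nonpos_of_isLocalMax hh2 hmax
  have h2 : f y - δ * ‖y‖ ^ 2 ≤ f x₀ := by
    have := hx₀ y
    simp only [hh] at this
    nlinarith [sq_nonneg ‖x₀‖]
  have h3 : μ * (f y - δ * ‖y‖ ^ 2) ≤ 6 * δ := by nlinarith
  have h4 : μ * f y = 2 * δ * μ * ‖y‖ ^ 2 + 12 * δ := by
    rw [hδ]; field_simp; ring
  have h6 : 0 ≤ δ * μ * ‖y‖ ^ 2 := by positivity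
  nlinarith

/-- **No bounded eigenfields with positive eigenvalue**: a bounded `C²` vector field on `ℝ³` with
`Δ w = μ w`, `μ > 0`, vanishes. -/
theorem eq_zero_of_laplacian_eq_smul_of_pos {w : E3 → E3} (hw : ContDiff ℝ 2 w) {μ : ℝ}
    (hμ : 0 < μ) (hΔ : ∀ x, (Δ w) x = μ • w x) {A : ℝ} (hA : ∀ x, ‖w x‖ ≤ A) (x : E3) :
    w x = 0 := by
  ext i
  set η : E3 → ℝ := fun z => w z i with hη
  have hηeq : η = (EuclideanSpace.proj i : E3 →L[ℝ] ℝ) ∘ w := by funext z; rfl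
  have hη2 : ContDiff ℝ 2 η := by
    rw [hηeq]; exact (EuclideanSpace.proj i : E3 →L[ℝ] ℝ).contDiff.comp hw
  have hηΔ : ∀ z, (Δ η) z = μ * η z := fun z => by
    rw [hηeq, hw.contDiffAt.laplacian_CLM_comp_left, Function.comp_apply, hΔ z]
    simp
  have hbd : ∀ z, |η z| ≤ A := fun z =>
    le_trans (by simpa [hη, Real.norm_eq_abs] using PiLp.norm_apply_le (w z) i) (hA z)
  have h1 := nonpos_of_laplacian_eq_mul hη2 hμ hηΔ (fun z => (le_abs_self _).trans (hbd z)) x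
  have hnΔ : ∀ z, (Δ (-η)) z = μ * (-η) z := fun z => by
    rw [InnerProductSpace.laplacian_neg, Pi.neg_apply, hηΔ z, Pi.neg_apply]; ring
  have h2 := nonpos_of_laplacian_eq_mul hη2.neg hμ hnΔ (fun z => (neg_le_abs _).trans (hbd z)) x
  have h2' : -η x ≤ 0 := h2
  have h3 : η x = 0 := by linarith
  simpa [hη] using h3

end Spatial

/-! ## B. The instrument and the rows -/

/-- The vortex-stretching bilinear form `B(v, w)(x) = (v·∇)w (x) − (w·∇)v (x)`. -/
def vortB (v w : E3 → E3) (x : E3) : E3 := fderiv ℝ w x (v x) - fderiv ℝ v x (w x)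

/-- The vorticity nonlinearity `N(v) = B(v, curl v) = (v·∇)ω − (ω·∇)v`, `ω = curl v`
(for divergence-free `v` this is `curl ((v·∇)v)`). -/
def vortNL (v : E3 → E3) (x : E3) : E3 := vortB v (curl v) x

/-- Bilinear expansion of `B` over finite sums (pointwise, under differentiability). -/
theorem vortB_sum_sum {ι κ : Type*} [Fintype ι] [Fintype κ] (ψ : ι → E3 → E3)
    (χ : κ → E3 → E3) (a : ι → ℝ) (c : κ → ℝ) {x : E3}
    (hψ : ∀ l, DifferentiableAt ℝ (ψ l) x) (hχ : ∀ j, DifferentiableAt ℝ (χ j) x) :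
    vortB (fun y => ∑ l, a l • ψ l y) (fun y => ∑ j, c j • χ j y) x =
      ∑ l, ∑ j, (a l * c j) • vortB (ψ l) (χ j) x := by
  have h1 : fderiv ℝ (fun y => ∑ l, a l • ψ l y) x = ∑ l, a l • fderiv ℝ (ψ l) x := by
    have : HasFDerivAt (fun y => ∑ l, a l • ψ l y) (∑ l, a l • fderiv ℝ (ψ l) x) x :=
      HasFDerivAt.fun_sum fun l _ => ((hψ l).hasFDerivAt.const_smul (a l))
    exact this.fderiv
  have h2 : fderiv ℝ (fun y => ∑ j, c j • χ j y) x = ∑ j, c j • fderiv ℝ (χ j) x := by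
    have : HasFDerivAt (fun y => ∑ j, c j • χ j y) (∑ j, c j • fderiv ℝ (χ j) x) x :=
      HasFDerivAt.fun_sum fun j _ => ((hχ j).hasFDerivAt.const_smul (c j))
    exact this.fderiv
  simp only [vortB, h1, h2, FunLike.coe_sum, Finset.sum_apply, FunLike.coe_smul,
    Pi.smul_apply,
    map_sum, map_smul, smul_sub, Finset.smul_sum, mul_smul, Finset.sum_sub_distrib]
  rw [Finset.sum_comm]
  congr 1
  rw [Finset.sum_comm]
  simp_rw [smul_comm (c _) (a _)]

-- `tendsto_typeI_bound`: the Type-I envelope `C/√(-s) → 0` at `-∞` restates a landed tree lemma (gate lint dedup.landed, twin `…Theorems.PolyhedralDssProfileExists.PolyhedralCell.tendsto_typeI_envelope_atBot`, whose module the farm does not build); not re-declared — its uses below carry the one-line Mathlib proof `(Real.tendsto_sqrt_atTop.comp tendsto_neg_atBot_atTop).const_div_atTop C` inline (port edit, proof text only).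

/-- The slices of a Type-I ancient mild field tend to zero pointwise in the far past. -/
theorem tendsto_slice_atBot {C : ℝ} {u : ℝ → E3 → E3} (hu : IsTypeIAncientMild C u) (x : E3) :
    Tendsto (fun s => u s x) atBot (𝓝 0) := by
  rw [tendsto_zero_iff_norm_tendsto_zero]
  refine squeeze_zero' (Eventually.of_forall fun s => norm_nonneg _) ?_ ((show Tendsto (fun s : ℝ => C / Real.sqrt (-s)) atBot (𝓝 0) from (Real.tendsto_sqrt_atTop.comp tendsto_neg_atBot_atTop).const_div_atTop C))
  filter_upwards [Iio_mem_atBot (0 : ℝ)] with s hs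
  exact hu.norm_le hs x

/-- Laplacian of the zero field. -/
theorem laplacian_zero_fun (x : E3) : (Δ (0 : E3 → E3)) x = 0 := by
  have h := InnerProductSpace.laplacian_smul (𝕜 := ℝ) (f := (0 : E3 → E3)) (x := x) (0 : ℝ)
    contDiffAt_const
  simpa using h

/-- Every element of the span of finitely many `C³` modes is `C³`, and its curl lies in the span
of the curls of the modes. -/
theorem span_modes {n : ℕ} {φ : Fin n → E3 → E3} (hφ : ∀ i, ContDiff ℝ 3 (φ i)) :
    ∀ v ∈ Submodule.span ℝ (Set.range φ),
      ContDiff ℝ 3 v ∧ curl v ∈ Submodule.span ℝ (Set.range fun i => curl (φ i)) := by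
  intro v hv
  induction hv using Submodule.span_induction with
  | mem v hv =>
    obtain ⟨i, rfl⟩ := hv
    exact ⟨hφ i, Submodule.subset_span ⟨i, rfl⟩⟩
  | zero =>
    refine ⟨contDiff_const, ?_⟩
    have : curl (0 : E3 → E3) = 0 := funext fun x => curl_zero x
    rw [this]; exact Submodule.zero_mem _
  | add v w _ _ hv hw =>
    refine ⟨hv.1.add hw.1, ?_⟩
    have : curl (v + w) = curl v + curl w := by
      funext x
      exact curl_add (hv.1.differentiable (by norm_num) x)
        (hw.1.differentiable (by norm_num) x)
    rw [this]; exact Submodule.add_mem _ hv.2 hw.2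
  | smul a v _ hv =>
    refine ⟨hv.1.const_smul a, ?_⟩
    have : curl (a • v) = a • curl v := by
      funext x
      exact curl_const_smul ((hv.1.differentiable (by norm_num) x)) a
    rw [this]; exact Submodule.smul_mem _ a hv.2

/-- Slices with coordinates in the modes lie in their span. -/
theorem slice_mem_span {u : ℝ → E3 → E3} {n : ℕ} {φ : Fin n → E3 → E3}
    (hsl : ∀ t < 0, ∃ a : Fin n → ℝ, ∀ x, u t x = ∑ i, a i • φ i x) :
    ∀ s < 0, u s ∈ Submodule.span ℝ (Set.range φ) := by
  intro s hs
  obtain ⟨a, ha⟩ := hsl s hs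
  have : u s = ∑ i, a i • φ i := by
    funext y; rw [ha y]; simp [Finset.sum_apply, Pi.smul_apply]
  rw [this]
  exact Submodule.sum_mem _ fun i _ => Submodule.smul_mem _ _ (Submodule.subset_span ⟨i, rfl⟩)

end Summit.NavierStokesRegularity.NavierStokesRegularity.Theorems.ScenarioCensus.ModeRank

end
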